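import Literature.MathematicalPhysics.QuantumLattice.HubbardTTPrimeThermalPressureLimit
import Literature.MathematicalPhysics.QuantumLattice.HubbardTTPrimeBoxWordExtension
import Mathlib.Analysis.SpecialFunctions.BinaryEntropy
import HarnessLib

/-!
# The THERMAL ANNEX of a `T = 0` box word: every certified ground-state energy word on a
# `(U, t', n)` box is a certified window for the thermal energy of the torus-limit Gibbs states and
# for the thermal pressure, on the same box, at EVERY temperature

Family `hubbard` (topic `MathematicalPhysics/QuantumLattice`); stage S2 of the Hubbard material oracle
(«certifier families: parameter BOXES, `t' ≠ 0`, `T > 0`», D-0096/D-0097) and the `T` axis of its phase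
maps (D-0098/D-0099). Companion of the `T = 0` box-word files (`HubbardTTPrimeBoxWordCovering`,
`…BoxWordExtension`, `…AffineBoxWords`, `…MultilinearBoxWordAdapters`: words
`F ≤ e(t, θ 1, θ 0, θ 2) ≤ C` on `θ ∈ Set.Icc lo hi`, coordinates `θ 0 = U`, `θ 1 = t'`, `θ 2 = n`,
`e = energyDensityTT'`) and of the `T > 0` objects of record: the torus limits `ω` of the canonical
sector Gibbs states (`InfVolFermionState.IsTorusLimitOfMixture (sectorGibbsCount n)
(sectorGibbsWeightTT' β t t' U n ·) (sectorGibbsVectorTT' t t' U n ·) Ls`, any `Ls → ∞`) with their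
thermal energy `e_Φ(ω) = ω.meanEnergy (hubbardTTPrimeFermionInteraction t t' U) 1`, and the pressure
number `pressureTT' β t t' U n` (`HubbardTTPrimeThermalPressureLimit`).

Nothing new is solved. Two rows of the tree, valid at every point, are read on boxes:

* the variational CUT `e(t,t',U,n) ≤ e_Φ(ω)` and the entropy CAP `e_Φ(ω) ≤ e(t,t',U,n) + 2·H_b(n/2)/β`
  for every torus-limit Gibbs state at `β > 0`
  (`IsTorusLimitOfMixture.energyDensityTT'_le_meanEnergy_of_sectorGibbs`,
  `…meanEnergy_hubbardTTPrime_le_energyDensityTT'_add_binEntropy_div`; `H_b` = `Real.binEntropy`, nats);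
* the a-priori pressure window `−β e ≤ p(β) ≤ 2·H_b(n/2) − β e` (`pressureTT'_mem_Icc`).

Hence (the whole content of this file), for a word with ARBITRARY floor / cap functions
`F, C : (Fin 3 → ℝ) → ℝ` (constant, affine, multilinear, …) on a box with `0 ≤ lo 0` (`U ≥ 0`),
`0 ≤ lo 2`, `hi 2 < 2`:

* §1 THERMAL ENERGY ANNEX: `F θ ≤ e_Φ(ω)` for every torus-limit Gibbs state at every `β`
  (`thermalFloor_Icc₃_of_floor`); `e_Φ(ω) ≤ C θ + 2·H_b(θ 2/2)/β` at `β > 0` (`thermalCap_Icc₃_of_cap`);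
  the window (`thermalWindow_Icc₃_of_word`); TEMPERATURE-RANGE cells `T ≤ 1/β₀` with a density-UNIFORM
  entropy constant — hole side `hi 2 ≤ 1`: `C θ + 2·H_b(hi 2/2)/β₀` (`thermalCap_Icc₃_of_cap_of_le`,
  `H_b` increasing on `[0, ½]`), electron side `1 ≤ lo 2`: `C θ + 2·H_b(lo 2/2)/β₀` (`…_of_le_electron`),
  any side: `C θ + log 4/β₀ ≤ C θ + 1.3863/β₀` (`…_of_le_log_four`, `…_decimal`).
* §2 THE HARVEST SHAPES: constant words on literal boxes `Set.Icc ![U₁,s₁,n₁] ![U₂,s₂,n₂]`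
  (`thermalWindow_of_constWord_Icc₃`, `…_electron`, `…_log_four`), affine words
  (`thermalWindow_of_affword_Icc₃`) and multilinear words (`thermalWindow_of_mlword_Icc₃`): the output is
  literally `∀ β, β₀ ≤ β → ∀ θ ∈ Set.Icc lo hi, ∀ ω Ls, … → F ≤ e_Φ(ω) ∧ e_Φ(ω) ≤ C + 2·H_b(n₂/2)/β₀`.
* §3 PRESSURE ANNEX: `−β·C θ ≤ p(β; t, θ 1, θ 0; θ 2) ≤ 2·H_b(θ 2/2) − β·F θ` for all `β ≥ 0`
  (`pressureWindow_Icc₃_of_word`, constant shape `pressureWindow_of_constWord_Icc₃`).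

Reading: the thermal annex costs `2·H_b(n/2)·T` on the cap side and nothing on the floor side —
`+0.343 t` at `(n, T) = (7/8, t/4)`, `+0.137 t` at `T = t/10`, `+0.027 t` at `T = t/50` (cuprate
`T_c`-scale temperatures): at phase-map temperatures a `T = 0` box word IS the thermal word to within a few
hundredths of `t`. Sharper `T > 0` words (cluster / Markov / KMS certificates, `TypeClassSidecarReader*`)
replace the cap where they exist; this file is the certificate-free baseline on EVERY box that carries a
`T = 0` word.

WHAT THIS IS NOT: a number of record; a new bound at any anchor; a statement about phases or `T_c`; a
grand-canonical / KMS statement (the thermal object is the tree's torus limit of canonical sector Gibbs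
states).

## Mathlib / tree search

`lean search 'binEntropy.*Icc.*vec|thermal.*word_Icc|meanEnergy.*Set.Icc !\['`: the only box-shaped
thermal row is the `t'`-interval form `meanEnergy_hubbardTTPrime_mem_Icc_on_tPrime_box_of_sectorGibbs`
(`HubbardTTPrimeDiagHopTransportThermal`, point floors at the interval ends); no `(U,t',n)`-box form.
REUSED: the two rows above, `pressureTT'_mem_Icc`, `mem_Icc_vec3_iff` (`HubbardTTPrimeBoxWordExtension`),
Mathlib `Real.binEntropy_strictMonoOn/_strictAntiOn/_le_log_two`, `Real.log_two_lt_d9`.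

## References

* R. B. Israel, *Convexity in the Theory of Lattice Gases* (1979), Lemma II.3.1 (Gibbs variational
  principle `e − T s ≤ f`). [cite: Israel1979, Lemma II.3.1]
* D. Ruelle, *Statistical Mechanics: Rigorous Results* (1969), §3.4. [cite: Ruelle1969, §3.4]
* A. Neumaier, *Complete search in continuous global optimization and constraint satisfaction*, Acta
  Numerica 13 (2004), §11 (interval enclosures on boxes). [cite: Neumaier2004CompleteSearch, §11]
-/

noncomputable section

namespace Literature.MathematicalPhysics.QuantumLattice

namespace ThermodynamicLimit

open Set
open _root_.Filter
open scoped _root_.Topology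

/-! ### §0 Bookkeeping: the entropy constant on a density slab -/

/-- `2·H_b(n/2)/β ≤ 2·H_b(n₂/2)/β₀` for `0 ≤ n ≤ n₂ ≤ 1` and `0 < β₀ ≤ β` (`H_b` is increasing on
`[0, ½]`). [cite: Ruelle1969, §3.4] -/
theorem two_mul_binEntropy_div_le_of_le_one {n n₂ β₀ β : ℝ} (hn0 : 0 ≤ n) (hn : n ≤ n₂) (hn₂ : n₂ ≤ 1)
    (hβ₀ : 0 < β₀) (hβ : β₀ ≤ β) :
    2 * Real.binEntropy (n / 2) / β ≤ 2 * Real.binEntropy (n₂ / 2) / β₀ := by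
  have hmono : Real.binEntropy (n / 2) ≤ Real.binEntropy (n₂ / 2) :=
    Real.binEntropy_strictMonoOn.monotoneOn ⟨by linarith, by norm_num; linarith⟩
      ⟨by linarith, by norm_num; linarith⟩ (by linarith)
  have hpos : 0 ≤ 2 * Real.binEntropy (n₂ / 2) :=
    mul_nonneg zero_le_two (Real.binEntropy_nonneg (by linarith) (by linarith))
  calc 2 * Real.binEntropy (n / 2) / β ≤ 2 * Real.binEntropy (n₂ / 2) / β :=
        div_le_div_of_nonneg_right (by linarith) (hβ₀.le.trans hβ)
    _ ≤ 2 * Real.binEntropy (n₂ / 2) / β₀ := div_le_div_of_nonneg_left hpos hβ₀ hβ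

/-- `2·H_b(n/2)/β ≤ 2·H_b(n₁/2)/β₀` for `1 ≤ n₁ ≤ n < 2` and `0 < β₀ ≤ β` (`H_b` is decreasing on
`[½, 1]`; the electron-doped side). [cite: Ruelle1969, §3.4] -/
theorem two_mul_binEntropy_div_le_of_one_le {n n₁ β₀ β : ℝ} (hn₁ : 1 ≤ n₁) (hn : n₁ ≤ n) (hn2 : n < 2)
    (hβ₀ : 0 < β₀) (hβ : β₀ ≤ β) :
    2 * Real.binEntropy (n / 2) / β ≤ 2 * Real.binEntropy (n₁ / 2) / β₀ := by
  have hmono : Real.binEntropy (n / 2) ≤ Real.binEntropy (n₁ / 2) :=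
    Real.binEntropy_strictAntiOn.antitoneOn ⟨by norm_num; linarith, by linarith⟩
      ⟨by norm_num; linarith, by linarith⟩ (by linarith)
  have hpos : 0 ≤ 2 * Real.binEntropy (n₁ / 2) :=
    mul_nonneg zero_le_two (Real.binEntropy_nonneg (by linarith) (by linarith))
  calc 2 * Real.binEntropy (n / 2) / β ≤ 2 * Real.binEntropy (n₁ / 2) / β :=
        div_le_div_of_nonneg_right (by linarith) (hβ₀.le.trans hβ)
    _ ≤ 2 * Real.binEntropy (n₁ / 2) / β₀ := div_le_div_of_nonneg_left hpos hβ₀ hβ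

/-- `2·H_b(p)/β ≤ log 4/β₀` for `0 < β₀ ≤ β` (any density). [cite: Ruelle1969, §3.4] -/
theorem two_mul_binEntropy_div_le_log_four {p β₀ β : ℝ} (hβ₀ : 0 < β₀) (hβ : β₀ ≤ β) :
    2 * Real.binEntropy p / β ≤ Real.log 4 / β₀ := by
  have h4 : Real.log 4 = 2 * Real.log 2 := by
    rw [show (4 : ℝ) = 2 ^ 2 by norm_num, Real.log_pow]; norm_num
  have hle : 2 * Real.binEntropy p ≤ Real.log 4 := by
    rw [h4]; exact mul_le_mul_of_nonneg_left Real.binEntropy_le_log_two zero_le_two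
  have hpos : 0 ≤ Real.log 4 := Real.log_nonneg (by norm_num)
  calc 2 * Real.binEntropy p / β ≤ Real.log 4 / β := div_le_div_of_nonneg_right hle (hβ₀.le.trans hβ)
    _ ≤ Real.log 4 / β₀ := div_le_div_of_nonneg_left hpos hβ₀ hβ

/-- `log 4/β₀ ≤ 1.3863/β₀` (`β₀ > 0`). [cite: Ruelle1969, §3.4] -/
theorem log_four_div_le_decimal {β₀ : ℝ} (hβ₀ : 0 < β₀) : Real.log 4 / β₀ ≤ 1.3863 / β₀ := by
  have h4 : Real.log 4 = 2 * Real.log 2 := by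
    rw [show (4 : ℝ) = 2 ^ 2 by norm_num, Real.log_pow]; norm_num
  have : Real.log 4 ≤ 1.3863 := by rw [h4]; have := Real.log_two_lt_d9; norm_num at this ⊢; linarith
  exact div_le_div_of_nonneg_right this hβ₀.le

/-! ### §1 The thermal energy annex of a word with arbitrary floor / cap functions -/

section General

variable (t : ℝ) {lo hi : Fin 3 → ℝ}

/-- **Floor side (every `β`).** A `T = 0` floor `F θ ≤ e(t, θ 1, θ 0, θ 2)` on a box with `0 ≤ lo 0`,
`0 ≤ lo 2`, `hi 2 < 2` is a floor on the thermal energy of EVERY torus-limit Gibbs state at every point of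
the box: `F θ ≤ e_Φ(ω)` (the variational cut). [cite: Israel1979, Lemma II.3.1] -/
theorem thermalFloor_Icc₃_of_floor (hU : 0 ≤ lo 0) (hn : 0 ≤ lo 2) (hn2 : hi 2 < 2)
    {F : (Fin 3 → ℝ) → ℝ} (hF : ∀ θ ∈ Set.Icc lo hi, F θ ≤ energyDensityTT' t (θ 1) (θ 0) (θ 2)) :
    ∀ β : ℝ, ∀ θ ∈ Set.Icc lo hi, ∀ (ω : InfVolFermionState 2) (Ls : ℕ → ℕ), Tendsto Ls atTop atTop →
      ω.IsTorusLimitOfMixture (sectorGibbsCount (θ 2)) (fun L => sectorGibbsWeightTT' β t (θ 1) (θ 0) (θ 2) L)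
        (fun L => sectorGibbsVectorTT' t (θ 1) (θ 0) (θ 2) L) Ls →
      F θ ≤ ω.meanEnergy (hubbardTTPrimeFermionInteraction t (θ 1) (θ 0)) 1 := by
  intro β θ hθ ω Ls hLs h
  have h0 : 0 ≤ θ 0 := hU.trans (hθ.1 0)
  have h2 : 0 ≤ θ 2 := hn.trans (hθ.1 2)
  have h2' : θ 2 < 2 := (hθ.2 2).trans_lt hn2
  exact (hF θ hθ).trans (h.energyDensityTT'_le_meanEnergy_of_sectorGibbs t (θ 1) (θ 0) h2 h2' β hLs (θ 1) h0)

/-- **Cap side (`β > 0`).** A `T = 0` cap `e(t, θ 1, θ 0, θ 2) ≤ C θ` on the box gives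
`e_Φ(ω) ≤ C θ + 2·H_b(θ 2/2)/β` for every torus-limit Gibbs state at inverse temperature `β > 0` at every
point of the box (entropy cap `s ≤ 2·H_b(n/2)` in `e − T s ≤ f ≤ e₀`). [cite: Israel1979, Lemma II.3.1] -/
theorem thermalCap_Icc₃_of_cap (hU : 0 ≤ lo 0) (hn : 0 ≤ lo 2) (hn2 : hi 2 < 2)
    {C : (Fin 3 → ℝ) → ℝ} (hC : ∀ θ ∈ Set.Icc lo hi, energyDensityTT' t (θ 1) (θ 0) (θ 2) ≤ C θ) :
    ∀ β : ℝ, 0 < β → ∀ θ ∈ Set.Icc lo hi, ∀ (ω : InfVolFermionState 2) (Ls : ℕ → ℕ),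
      Tendsto Ls atTop atTop →
      ω.IsTorusLimitOfMixture (sectorGibbsCount (θ 2)) (fun L => sectorGibbsWeightTT' β t (θ 1) (θ 0) (θ 2) L)
        (fun L => sectorGibbsVectorTT' t (θ 1) (θ 0) (θ 2) L) Ls →
      ω.meanEnergy (hubbardTTPrimeFermionInteraction t (θ 1) (θ 0)) 1 ≤
        C θ + 2 * Real.binEntropy (θ 2 / 2) / β := by
  intro β hβ θ hθ ω Ls hLs h
  have h0 : 0 ≤ θ 0 := hU.trans (hθ.1 0)
  have h2 : 0 ≤ θ 2 := hn.trans (hθ.1 2)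
  have h2' : θ 2 < 2 := (hθ.2 2).trans_lt hn2
  have hcap := h.meanEnergy_hubbardTTPrime_le_energyDensityTT'_add_binEntropy_div t (θ 1) h0 h2 h2' hβ hLs
  linarith [hC θ hθ]

/-- **The thermal window of a two-sided word** at `β > 0`: `F θ ≤ e_Φ(ω) ≤ C θ + 2·H_b(θ 2/2)/β`.
[cite: Israel1979, Lemma II.3.1] -/
theorem thermalWindow_Icc₃_of_word (hU : 0 ≤ lo 0) (hn : 0 ≤ lo 2) (hn2 : hi 2 < 2)
    {F C : (Fin 3 → ℝ) → ℝ}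
    (hW : ∀ θ ∈ Set.Icc lo hi, F θ ≤ energyDensityTT' t (θ 1) (θ 0) (θ 2) ∧
      energyDensityTT' t (θ 1) (θ 0) (θ 2) ≤ C θ) :
    ∀ β : ℝ, 0 < β → ∀ θ ∈ Set.Icc lo hi, ∀ (ω : InfVolFermionState 2) (Ls : ℕ → ℕ),
      Tendsto Ls atTop atTop →
      ω.IsTorusLimitOfMixture (sectorGibbsCount (θ 2)) (fun L => sectorGibbsWeightTT' β t (θ 1) (θ 0) (θ 2) L)
        (fun L => sectorGibbsVectorTT' t (θ 1) (θ 0) (θ 2) L) Ls →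
      F θ ≤ ω.meanEnergy (hubbardTTPrimeFermionInteraction t (θ 1) (θ 0)) 1 ∧
        ω.meanEnergy (hubbardTTPrimeFermionInteraction t (θ 1) (θ 0)) 1 ≤
          C θ + 2 * Real.binEntropy (θ 2 / 2) / β :=
  fun β hβ θ hθ ω Ls hLs h =>
    ⟨thermalFloor_Icc₃_of_floor t hU hn hn2 (fun θ hθ => (hW θ hθ).1) β θ hθ ω Ls hLs h,
      thermalCap_Icc₃_of_cap t hU hn hn2 (fun θ hθ => (hW θ hθ).2) β hβ θ hθ ω Ls hLs h⟩

/-- **Temperature-range cell, hole side.** On a box with `hi 2 ≤ 1` the cap holds UNIFORMLY on the cell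
`T ≤ 1/β₀`, i.e. for every `β ≥ β₀ > 0`: `e_Φ(ω) ≤ C θ + 2·H_b(hi 2/2)/β₀`.
[cite: Israel1979, Lemma II.3.1] -/
theorem thermalCap_Icc₃_of_cap_of_le (hU : 0 ≤ lo 0) (hn : 0 ≤ lo 2) (hn1 : hi 2 ≤ 1)
    {C : (Fin 3 → ℝ) → ℝ} (hC : ∀ θ ∈ Set.Icc lo hi, energyDensityTT' t (θ 1) (θ 0) (θ 2) ≤ C θ)
    {β₀ : ℝ} (hβ₀ : 0 < β₀) :
    ∀ β : ℝ, β₀ ≤ β → ∀ θ ∈ Set.Icc lo hi, ∀ (ω : InfVolFermionState 2) (Ls : ℕ → ℕ),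
      Tendsto Ls atTop atTop →
      ω.IsTorusLimitOfMixture (sectorGibbsCount (θ 2)) (fun L => sectorGibbsWeightTT' β t (θ 1) (θ 0) (θ 2) L)
        (fun L => sectorGibbsVectorTT' t (θ 1) (θ 0) (θ 2) L) Ls →
      ω.meanEnergy (hubbardTTPrimeFermionInteraction t (θ 1) (θ 0)) 1 ≤
        C θ + 2 * Real.binEntropy (hi 2 / 2) / β₀ := by
  intro β hβ θ hθ ω Ls hLs h
  have hcap := thermalCap_Icc₃_of_cap t hU hn (by linarith) hC β (hβ₀.trans_le hβ) θ hθ ω Ls hLs h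
  have hent := two_mul_binEntropy_div_le_of_le_one (hn.trans (hθ.1 2)) (hθ.2 2) hn1 hβ₀ hβ
  linarith

/-- **Temperature-range cell, electron side** (`1 ≤ lo 2`, `hi 2 < 2`): for every `β ≥ β₀ > 0`,
`e_Φ(ω) ≤ C θ + 2·H_b(lo 2/2)/β₀`. [cite: Israel1979, Lemma II.3.1] -/
theorem thermalCap_Icc₃_of_cap_of_le_electron (hU : 0 ≤ lo 0) (hn1 : 1 ≤ lo 2) (hn2 : hi 2 < 2)
    {C : (Fin 3 → ℝ) → ℝ} (hC : ∀ θ ∈ Set.Icc lo hi, energyDensityTT' t (θ 1) (θ 0) (θ 2) ≤ C θ)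
    {β₀ : ℝ} (hβ₀ : 0 < β₀) :
    ∀ β : ℝ, β₀ ≤ β → ∀ θ ∈ Set.Icc lo hi, ∀ (ω : InfVolFermionState 2) (Ls : ℕ → ℕ),
      Tendsto Ls atTop atTop →
      ω.IsTorusLimitOfMixture (sectorGibbsCount (θ 2)) (fun L => sectorGibbsWeightTT' β t (θ 1) (θ 0) (θ 2) L)
        (fun L => sectorGibbsVectorTT' t (θ 1) (θ 0) (θ 2) L) Ls →
      ω.meanEnergy (hubbardTTPrimeFermionInteraction t (θ 1) (θ 0)) 1 ≤
        C θ + 2 * Real.binEntropy (lo 2 / 2) / β₀ := by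
  intro β hβ θ hθ ω Ls hLs h
  have hcap := thermalCap_Icc₃_of_cap t hU (by linarith) hn2 hC β (hβ₀.trans_le hβ) θ hθ ω Ls hLs h
  have hent := two_mul_binEntropy_div_le_of_one_le hn1 (hθ.1 2) ((hθ.2 2).trans_lt hn2) hβ₀ hβ
  linarith

/-- **Temperature-range cell, any density**: for every `β ≥ β₀ > 0`, `e_Φ(ω) ≤ C θ + log 4/β₀`.
[cite: Israel1979, Lemma II.3.1] -/
theorem thermalCap_Icc₃_of_cap_of_le_log_four (hU : 0 ≤ lo 0) (hn : 0 ≤ lo 2) (hn2 : hi 2 < 2)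
    {C : (Fin 3 → ℝ) → ℝ} (hC : ∀ θ ∈ Set.Icc lo hi, energyDensityTT' t (θ 1) (θ 0) (θ 2) ≤ C θ)
    {β₀ : ℝ} (hβ₀ : 0 < β₀) :
    ∀ β : ℝ, β₀ ≤ β → ∀ θ ∈ Set.Icc lo hi, ∀ (ω : InfVolFermionState 2) (Ls : ℕ → ℕ),
      Tendsto Ls atTop atTop →
      ω.IsTorusLimitOfMixture (sectorGibbsCount (θ 2)) (fun L => sectorGibbsWeightTT' β t (θ 1) (θ 0) (θ 2) L)
        (fun L => sectorGibbsVectorTT' t (θ 1) (θ 0) (θ 2) L) Ls →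
      ω.meanEnergy (hubbardTTPrimeFermionInteraction t (θ 1) (θ 0)) 1 ≤ C θ + Real.log 4 / β₀ := by
  intro β hβ θ hθ ω Ls hLs h
  have hcap := thermalCap_Icc₃_of_cap t hU hn hn2 hC β (hβ₀.trans_le hβ) θ hθ ω Ls hLs h
  have hent := two_mul_binEntropy_div_le_log_four (p := θ 2 / 2) hβ₀ hβ
  linarith

end General

/-! ### §2 The harvest shapes: constant, affine and multilinear words on literal boxes -/

section Shapes

variable (t : ℝ) {U₁ U₂ s₁ s₂ n₁ n₂ : ℝ}

/-- **Thermal annex of a CONSTANT word, hole side** (`0 ≤ U₁`, `0 ≤ n₁`, `n₂ ≤ 1`; cell `T ≤ 1/β₀`):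
`F ≤ e_Φ(ω) ≤ C + 2·H_b(n₂/2)/β₀` for every `β ≥ β₀`, every `θ ∈ Set.Icc ![U₁,s₁,n₁] ![U₂,s₂,n₂]` and every
torus-limit Gibbs state `ω` at `(β, t, θ 1, θ 0, θ 2)`. [cite: Israel1979, Lemma II.3.1]
[cite: Neumaier2004CompleteSearch, §11] -/
theorem thermalWindow_of_constWord_Icc₃ (hU₁ : 0 ≤ U₁) (hn₁ : 0 ≤ n₁) (hn₂ : n₂ ≤ 1) {F C : ℝ}
    (h : ∀ θ ∈ Set.Icc (![U₁, s₁, n₁] : Fin 3 → ℝ) ![U₂, s₂, n₂],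
      F ≤ energyDensityTT' t (θ 1) (θ 0) (θ 2) ∧ energyDensityTT' t (θ 1) (θ 0) (θ 2) ≤ C)
    {β₀ : ℝ} (hβ₀ : 0 < β₀) :
    ∀ β : ℝ, β₀ ≤ β → ∀ θ ∈ Set.Icc (![U₁, s₁, n₁] : Fin 3 → ℝ) ![U₂, s₂, n₂],
      ∀ (ω : InfVolFermionState 2) (Ls : ℕ → ℕ), Tendsto Ls atTop atTop →
      ω.IsTorusLimitOfMixture (sectorGibbsCount (θ 2)) (fun L => sectorGibbsWeightTT' β t (θ 1) (θ 0) (θ 2) L)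
        (fun L => sectorGibbsVectorTT' t (θ 1) (θ 0) (θ 2) L) Ls →
      F ≤ ω.meanEnergy (hubbardTTPrimeFermionInteraction t (θ 1) (θ 0)) 1 ∧
        ω.meanEnergy (hubbardTTPrimeFermionInteraction t (θ 1) (θ 0)) 1 ≤
          C + 2 * Real.binEntropy (n₂ / 2) / β₀ := by
  intro β hβ θ hθ ω Ls hLs hω
  have hU : (0 : ℝ) ≤ (![U₁, s₁, n₁] : Fin 3 → ℝ) 0 := by simpa using hU₁
  have hn : (0 : ℝ) ≤ (![U₁, s₁, n₁] : Fin 3 → ℝ) 2 := by simpa using hn₁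
  have hn1 : (![U₂, s₂, n₂] : Fin 3 → ℝ) 2 ≤ 1 := by simpa using hn₂
  refine ⟨thermalFloor_Icc₃_of_floor t hU hn (by simp; linarith) (F := fun _ => F)
      (fun θ hθ => (h θ hθ).1) β θ hθ ω Ls hLs hω, ?_⟩
  have := thermalCap_Icc₃_of_cap_of_le t hU hn hn1 (C := fun _ => C) (fun θ hθ => (h θ hθ).2) hβ₀ β hβ
    θ hθ ω Ls hLs hω
  simpa using this

/-- **Thermal annex of a CONSTANT word, electron side** (`0 ≤ U₁`, `1 ≤ n₁`, `n₂ < 2`):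
`F ≤ e_Φ(ω) ≤ C + 2·H_b(n₁/2)/β₀` for every `β ≥ β₀`. [cite: Israel1979, Lemma II.3.1]
[cite: Neumaier2004CompleteSearch, §11] -/
theorem thermalWindow_of_constWord_Icc₃_electron (hU₁ : 0 ≤ U₁) (hn₁ : 1 ≤ n₁) (hn₂ : n₂ < 2)
    {F C : ℝ}
    (h : ∀ θ ∈ Set.Icc (![U₁, s₁, n₁] : Fin 3 → ℝ) ![U₂, s₂, n₂],
      F ≤ energyDensityTT' t (θ 1) (θ 0) (θ 2) ∧ energyDensityTT' t (θ 1) (θ 0) (θ 2) ≤ C)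
    {β₀ : ℝ} (hβ₀ : 0 < β₀) :
    ∀ β : ℝ, β₀ ≤ β → ∀ θ ∈ Set.Icc (![U₁, s₁, n₁] : Fin 3 → ℝ) ![U₂, s₂, n₂],
      ∀ (ω : InfVolFermionState 2) (Ls : ℕ → ℕ), Tendsto Ls atTop atTop →
      ω.IsTorusLimitOfMixture (sectorGibbsCount (θ 2)) (fun L => sectorGibbsWeightTT' β t (θ 1) (θ 0) (θ 2) L)
        (fun L => sectorGibbsVectorTT' t (θ 1) (θ 0) (θ 2) L) Ls →
      F ≤ ω.meanEnergy (hubbardTTPrimeFermionInteraction t (θ 1) (θ 0)) 1 ∧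
        ω.meanEnergy (hubbardTTPrimeFermionInteraction t (θ 1) (θ 0)) 1 ≤
          C + 2 * Real.binEntropy (n₁ / 2) / β₀ := by
  intro β hβ θ hθ ω Ls hLs hω
  have hU : (0 : ℝ) ≤ (![U₁, s₁, n₁] : Fin 3 → ℝ) 0 := by simpa using hU₁
  have hn : (1 : ℝ) ≤ (![U₁, s₁, n₁] : Fin 3 → ℝ) 2 := by simpa using hn₁
  have hn2 : (![U₂, s₂, n₂] : Fin 3 → ℝ) 2 < 2 := by simpa using hn₂
  refine ⟨thermalFloor_Icc₃_of_floor t hU (by simp; linarith) hn2 (F := fun _ => F)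
      (fun θ hθ => (h θ hθ).1) β θ hθ ω Ls hLs hω, ?_⟩
  have := thermalCap_Icc₃_of_cap_of_le_electron t hU hn hn2 (C := fun _ => C) (fun θ hθ => (h θ hθ).2)
    hβ₀ β hβ θ hθ ω Ls hLs hω
  simpa using this

/-- **Thermal annex of a CONSTANT word, any density** (`0 ≤ U₁`, `0 ≤ n₁`, `n₂ < 2`):
`F ≤ e_Φ(ω) ≤ C + 1.3863/β₀` for every `β ≥ β₀` (`log 4 ≤ 1.3863`). [cite: Israel1979, Lemma II.3.1]
[cite: Neumaier2004CompleteSearch, §11] -/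
theorem thermalWindow_of_constWord_Icc₃_decimal (hU₁ : 0 ≤ U₁) (hn₁ : 0 ≤ n₁) (hn₂ : n₂ < 2) {F C : ℝ}
    (h : ∀ θ ∈ Set.Icc (![U₁, s₁, n₁] : Fin 3 → ℝ) ![U₂, s₂, n₂],
      F ≤ energyDensityTT' t (θ 1) (θ 0) (θ 2) ∧ energyDensityTT' t (θ 1) (θ 0) (θ 2) ≤ C)
    {β₀ : ℝ} (hβ₀ : 0 < β₀) :
    ∀ β : ℝ, β₀ ≤ β → ∀ θ ∈ Set.Icc (![U₁, s₁, n₁] : Fin 3 → ℝ) ![U₂, s₂, n₂],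
      ∀ (ω : InfVolFermionState 2) (Ls : ℕ → ℕ), Tendsto Ls atTop atTop →
      ω.IsTorusLimitOfMixture (sectorGibbsCount (θ 2)) (fun L => sectorGibbsWeightTT' β t (θ 1) (θ 0) (θ 2) L)
        (fun L => sectorGibbsVectorTT' t (θ 1) (θ 0) (θ 2) L) Ls →
      F ≤ ω.meanEnergy (hubbardTTPrimeFermionInteraction t (θ 1) (θ 0)) 1 ∧
        ω.meanEnergy (hubbardTTPrimeFermionInteraction t (θ 1) (θ 0)) 1 ≤ C + 1.3863 / β₀ := by
  intro β hβ θ hθ ω Ls hLs hω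
  have hU : (0 : ℝ) ≤ (![U₁, s₁, n₁] : Fin 3 → ℝ) 0 := by simpa using hU₁
  have hn : (0 : ℝ) ≤ (![U₁, s₁, n₁] : Fin 3 → ℝ) 2 := by simpa using hn₁
  have hn2 : (![U₂, s₂, n₂] : Fin 3 → ℝ) 2 < 2 := by simpa using hn₂
  refine ⟨thermalFloor_Icc₃_of_floor t hU hn hn2 (F := fun _ => F) (fun θ hθ => (h θ hθ).1) β θ hθ ω Ls
      hLs hω, ?_⟩
  have hc := thermalCap_Icc₃_of_cap_of_le_log_four t hU hn hn2 (C := fun _ => C) (fun θ hθ => (h θ hθ).2)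
    hβ₀ β hβ θ hθ ω Ls hLs hω
  have hd := log_four_div_le_decimal hβ₀
  linarith

/-- **Thermal annex of an AFFINE word** (`0 ≤ lo 0`, `0 ≤ lo 2`, `hi 2 ≤ 1`; cell `T ≤ 1/β₀`): the affine
floor stays, the affine cap is lifted by `2·H_b(hi 2/2)/β₀`. [cite: Israel1979, Lemma II.3.1]
[cite: Neumaier2004CompleteSearch, §11] -/
theorem thermalWindow_of_affword_Icc₃ {lo hi : Fin 3 → ℝ} (hU : 0 ≤ lo 0) (hn : 0 ≤ lo 2) (hn1 : hi 2 ≤ 1)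
    {L₀ L₁ L₂ L₃ H₀ H₁ H₂ H₃ : ℝ}
    (h : ∀ θ ∈ Set.Icc lo hi, L₀ + L₁ * θ 0 + L₂ * θ 1 + L₃ * θ 2 ≤ energyDensityTT' t (θ 1) (θ 0) (θ 2) ∧
      energyDensityTT' t (θ 1) (θ 0) (θ 2) ≤ H₀ + H₁ * θ 0 + H₂ * θ 1 + H₃ * θ 2)
    {β₀ : ℝ} (hβ₀ : 0 < β₀) :
    ∀ β : ℝ, β₀ ≤ β → ∀ θ ∈ Set.Icc lo hi, ∀ (ω : InfVolFermionState 2) (Ls : ℕ → ℕ),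
      Tendsto Ls atTop atTop →
      ω.IsTorusLimitOfMixture (sectorGibbsCount (θ 2)) (fun L => sectorGibbsWeightTT' β t (θ 1) (θ 0) (θ 2) L)
        (fun L => sectorGibbsVectorTT' t (θ 1) (θ 0) (θ 2) L) Ls →
      L₀ + L₁ * θ 0 + L₂ * θ 1 + L₃ * θ 2 ≤ ω.meanEnergy (hubbardTTPrimeFermionInteraction t (θ 1) (θ 0)) 1 ∧
        ω.meanEnergy (hubbardTTPrimeFermionInteraction t (θ 1) (θ 0)) 1 ≤
          H₀ + H₁ * θ 0 + H₂ * θ 1 + H₃ * θ 2 + 2 * Real.binEntropy (hi 2 / 2) / β₀ :=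
  fun β hβ θ hθ ω Ls hLs hω =>
    ⟨thermalFloor_Icc₃_of_floor t hU hn (by linarith) (F := fun θ => L₀ + L₁ * θ 0 + L₂ * θ 1 + L₃ * θ 2)
        (fun θ hθ => (h θ hθ).1) β θ hθ ω Ls hLs hω,
      thermalCap_Icc₃_of_cap_of_le t hU hn hn1 (C := fun θ => H₀ + H₁ * θ 0 + H₂ * θ 1 + H₃ * θ 2)
        (fun θ hθ => (h θ hθ).2) hβ₀ β hβ θ hθ ω Ls hLs hω⟩

/-- **Thermal annex of a MULTILINEAR word** (`0 ≤ lo 0`, `0 ≤ lo 2`, `hi 2 ≤ 1`; cell `T ≤ 1/β₀`).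
[cite: Israel1979, Lemma II.3.1] [cite: Neumaier2004CompleteSearch, §11] -/
theorem thermalWindow_of_mlword_Icc₃ {lo hi : Fin 3 → ℝ} (hU : 0 ≤ lo 0) (hn : 0 ≤ lo 2) (hn1 : hi 2 ≤ 1)
    {c₀ c₁ c₂ c₃ c₄ c₅ c₆ c₇ d₀ d₁ d₂ d₃ d₄ d₅ d₆ d₇ : ℝ}
    (h : ∀ θ ∈ Set.Icc lo hi,
      c₀ + c₁ * θ 0 + c₂ * θ 1 + c₃ * θ 2 + c₄ * θ 0 * θ 1 + c₅ * θ 0 * θ 2 + c₆ * θ 1 * θ 2 +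
          c₇ * θ 0 * θ 1 * θ 2 ≤ energyDensityTT' t (θ 1) (θ 0) (θ 2) ∧
        energyDensityTT' t (θ 1) (θ 0) (θ 2) ≤ d₀ + d₁ * θ 0 + d₂ * θ 1 + d₃ * θ 2 + d₄ * θ 0 * θ 1 +
          d₅ * θ 0 * θ 2 + d₆ * θ 1 * θ 2 + d₇ * θ 0 * θ 1 * θ 2)
    {β₀ : ℝ} (hβ₀ : 0 < β₀) :
    ∀ β : ℝ, β₀ ≤ β → ∀ θ ∈ Set.Icc lo hi, ∀ (ω : InfVolFermionState 2) (Ls : ℕ → ℕ),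
      Tendsto Ls atTop atTop →
      ω.IsTorusLimitOfMixture (sectorGibbsCount (θ 2)) (fun L => sectorGibbsWeightTT' β t (θ 1) (θ 0) (θ 2) L)
        (fun L => sectorGibbsVectorTT' t (θ 1) (θ 0) (θ 2) L) Ls →
      c₀ + c₁ * θ 0 + c₂ * θ 1 + c₃ * θ 2 + c₄ * θ 0 * θ 1 + c₅ * θ 0 * θ 2 + c₆ * θ 1 * θ 2 +
          c₇ * θ 0 * θ 1 * θ 2 ≤ ω.meanEnergy (hubbardTTPrimeFermionInteraction t (θ 1) (θ 0)) 1 ∧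
        ω.meanEnergy (hubbardTTPrimeFermionInteraction t (θ 1) (θ 0)) 1 ≤
          d₀ + d₁ * θ 0 + d₂ * θ 1 + d₃ * θ 2 + d₄ * θ 0 * θ 1 + d₅ * θ 0 * θ 2 + d₆ * θ 1 * θ 2 +
            d₇ * θ 0 * θ 1 * θ 2 + 2 * Real.binEntropy (hi 2 / 2) / β₀ :=
  fun β hβ θ hθ ω Ls hLs hω =>
    ⟨thermalFloor_Icc₃_of_floor t hU hn (by linarith)
        (F := fun θ => c₀ + c₁ * θ 0 + c₂ * θ 1 + c₃ * θ 2 + c₄ * θ 0 * θ 1 + c₅ * θ 0 * θ 2 +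
          c₆ * θ 1 * θ 2 + c₇ * θ 0 * θ 1 * θ 2)
        (fun θ hθ => (h θ hθ).1) β θ hθ ω Ls hLs hω,
      thermalCap_Icc₃_of_cap_of_le t hU hn hn1
        (C := fun θ => d₀ + d₁ * θ 0 + d₂ * θ 1 + d₃ * θ 2 + d₄ * θ 0 * θ 1 + d₅ * θ 0 * θ 2 +
          d₆ * θ 1 * θ 2 + d₇ * θ 0 * θ 1 * θ 2)
        (fun θ hθ => (h θ hθ).2) hβ₀ β hβ θ hθ ω Ls hLs hω⟩

end Shapes

/-! ### §3 The pressure annex of a word -/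

section Pressure

variable (t : ℝ) {lo hi : Fin 3 → ℝ}

/-- **Pressure window from a `T = 0` word.** On a box with `0 ≤ lo 0`, `0 ≤ lo 2`, `hi 2 < 2`, a word
`F θ ≤ e ≤ C θ` gives, for every `β ≥ 0` and every `θ` in the box,
`−β·C θ ≤ p(β; t, θ 1, θ 0; θ 2) ≤ 2·H_b(θ 2/2) − β·F θ` (`p = pressureTT'`; the ground state as a trial
state, and the entropy ceiling `2·H_b(n/2)`). [cite: Ruelle1969, §3.4] -/
theorem pressureWindow_Icc₃_of_word (hU : 0 ≤ lo 0) (hn : 0 ≤ lo 2) (hn2 : hi 2 < 2)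
    {F C : (Fin 3 → ℝ) → ℝ}
    (hW : ∀ θ ∈ Set.Icc lo hi, F θ ≤ energyDensityTT' t (θ 1) (θ 0) (θ 2) ∧
      energyDensityTT' t (θ 1) (θ 0) (θ 2) ≤ C θ) :
    ∀ β : ℝ, 0 ≤ β → ∀ θ ∈ Set.Icc lo hi,
      -(β * C θ) ≤ pressureTT' β t (θ 1) (θ 0) (θ 2) ∧
        pressureTT' β t (θ 1) (θ 0) (θ 2) ≤ 2 * Real.binEntropy (θ 2 / 2) - β * F θ := by
  intro β hβ θ hθ
  have h0 : 0 ≤ θ 0 := hU.trans (hθ.1 0)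
  have h2 : 0 ≤ θ 2 := hn.trans (hθ.1 2)
  have h2' : θ 2 < 2 := (hθ.2 2).trans_lt hn2
  obtain ⟨hlo, hhi⟩ := pressureTT'_mem_Icc hβ t (θ 1) h0 h2 h2'
  obtain ⟨hF, hC⟩ := hW θ hθ
  have h1 : β * energyDensityTT' t (θ 1) (θ 0) (θ 2) ≤ β * C θ := mul_le_mul_of_nonneg_left hC hβ
  have h3 : β * F θ ≤ β * energyDensityTT' t (θ 1) (θ 0) (θ 2) := mul_le_mul_of_nonneg_left hF hβ
  exact ⟨by linarith, by linarith⟩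

/-- **Pressure window from a CONSTANT word on a literal box** (`0 ≤ U₁`, `0 ≤ n₁`, `n₂ < 2`): for every
`β ≥ 0` and `θ ∈ Set.Icc ![U₁,s₁,n₁] ![U₂,s₂,n₂]`, `−β·C ≤ p ≤ 2·H_b(θ 2/2) − β·F`.
[cite: Ruelle1969, §3.4] [cite: Neumaier2004CompleteSearch, §11] -/
theorem pressureWindow_of_constWord_Icc₃ {U₁ U₂ s₁ s₂ n₁ n₂ : ℝ} (hU₁ : 0 ≤ U₁) (hn₁ : 0 ≤ n₁)
    (hn₂ : n₂ < 2) {F C : ℝ}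
    (h : ∀ θ ∈ Set.Icc (![U₁, s₁, n₁] : Fin 3 → ℝ) ![U₂, s₂, n₂],
      F ≤ energyDensityTT' t (θ 1) (θ 0) (θ 2) ∧ energyDensityTT' t (θ 1) (θ 0) (θ 2) ≤ C) :
    ∀ β : ℝ, 0 ≤ β → ∀ θ ∈ Set.Icc (![U₁, s₁, n₁] : Fin 3 → ℝ) ![U₂, s₂, n₂],
      -(β * C) ≤ pressureTT' β t (θ 1) (θ 0) (θ 2) ∧
        pressureTT' β t (θ 1) (θ 0) (θ 2) ≤ 2 * Real.binEntropy (θ 2 / 2) - β * F := by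
  have hU : (0 : ℝ) ≤ (![U₁, s₁, n₁] : Fin 3 → ℝ) 0 := by simpa using hU₁
  have hn : (0 : ℝ) ≤ (![U₁, s₁, n₁] : Fin 3 → ℝ) 2 := by simpa using hn₁
  have hn2 : (![U₂, s₂, n₂] : Fin 3 → ℝ) 2 < 2 := by simpa using hn₂
  intro β hβ θ hθ
  simpa using pressureWindow_Icc₃_of_word t hU hn hn2 (F := fun _ => F) (C := fun _ => C) h β hβ θ hθ

end Pressure

end ThermodynamicLimit

end Literature.MathematicalPhysics.QuantumLattice

end
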